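import Literature.AlgebraicGeometry.HodgeTheory.AbsoluteHodgeClasses
import Literature.NumberTheory.Transcendental.AnalytificationUniquenessProofs
import Literature.NumberTheory.Transcendental.ComplexFormsPullback
import Literature.Geometry.Kaehler.ManifoldFormsPullback
import Literature.Geometry.Kaehler.PluriharmonicLog
import HarnessLib

/-!
# Realisations of algebraic form expressions are natural in the analytic model

Topic `Literature/AlgebraicGeometry/HodgeTheory`. For a smooth affine `ℂ`-scheme `Y`, the tree reads
algebraic differential forms on `Y^an` through EXPRESSIONS `ξ = ∑ⱼ fⱼ dg_{j,1} ∧ ⋯ ∧ dg_{j,k}`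
(`AlgFormExpr`, `AbsoluteHodgeClasses`) realised on an ANALYTIC MODEL `A : AnalyticModel E m Y`
(`ξ.realize A`, a smooth complex `k`-form on `A.carrier`), and conjugation charts / the named fact
`chartConjugation_canonical` (clause (iii)) quantify over ALL analytic models. This file proves that
nothing depends on the model:

* `AnalyticModel.mdifferentiable_regularFun`, `.contMDiff_regularFun`, `.isSmoothForm_ofFun_regularFun` —
  global regular functions are holomorphic, hence real `C^∞`, on `Y^an` (`IsAnalytification` on the
  affine open `⊤`; Osgood);
* `pullback_ofFun`, `dFun_pullback`, `dWedge_pullback` — `f^*(dg₁ ∧ ⋯ ∧ dg_k) = d(g₁ ∘ f) ∧ ⋯ ∧ d(g_k ∘ f)`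
  for a `C^∞` map `f` (naturality of `d`, Warner 2.23, and of `∧`, Warner 2.22(c));
* `AlgFormExpr.realize_pullback` — for two models `A`, `B` of `Y` on one model space `E` and a `C^∞` map
  `φ : A.carrier → B.carrier` over `Y(ℂ)` (`B.toComplexPoints ∘ φ = A.toComplexPoints`):
  `φ^* (ξ.realize B) = ξ.realize A`; on classes `AlgFormExpr.map_mk_realize`;
* `AnalyticModel.exists_homeomorph` — two models of `Y` on `E` differ by a homeomorphism over `Y(ℂ)`
  which is `C^∞` in both directions (uniqueness of the analytification, Serre GAGA §2 n°5,
  `IsAnalytification.unique_holds`, and "holomorphic ⇒ `C^∞`");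
* `AnalyticModel.pullback_comp_map` — `A^* = φ^* ∘ B^*` on `Hᵏ(–; ℂ)` for such `φ`;
* `AlgFormExpr.pullback_eq_deRham_realize_iff` — **model independence of reading a class through an
  expression**: for a NATURAL complex de Rham family `e` on `E`-manifolds,
  `A^* c = e[ξ.realize A] ↔ B^* c = e[ξ.realize B]`. This is the `A`-independence in clause (iii) of
  `chartConjugation_canonical` and in `ConjugationChart.Conjugates`, as a theorem.

* `AlgFormExpr.pullback`, `AnalyticModel.anMap` (+ `mdifferentiable_anMap`, `contMDiff_anMap`,
  `regularFun_appTop`, `pullback_map_eq`), `AlgFormExpr.realize_pullback_anMap`, `.map_mk_realize_anMap`,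
  `.pullback_map_eq_deRham_realize` — the same NATURALITY ALONG `ℂ`-MORPHISMS `h : Y₁ ⟶ Y₂` (the
  analytified map `h^an` is holomorphic by `IsAnalytification.mdifferentiable_comp_map_holds`;
  `(h^an)^* (ξ.realize A₂) = (h^* ξ).realize A₁`; reading classes through expressions is natural for a
  natural de Rham family on one model space) — the input to clause (ii) of `chartConjugation_canonical`.

* `AlgFormExpr.pullback_id`, `.realize_pullback_anMap_id`, `.map_mk_realize_anMap_id`,
  `AnalyticModel.pullback_eq_map_anMap_id` — model independence ACROSS MODEL SPACES (models of one `Y` on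
  `E₁`, `E₂`, compared along `𝟙^an = ψ_B⁻¹ ∘ ψ_A`); with the cross-model naturality of the integration
  families (`integrationDeRhamIsoFamily_complexify_natural₂`, `DeRhamTheoremProofs`) this replaces any
  transport of manifolds along `E₁ ≃L E₂`.

References: Serre, GAGA (1956) §2 n°5 (unicité et fonctorialité de `X^h`); Warner (1983) 2.22–2.23;
Bott–Tu (1982) §I.2 (naturality of `f^*` on de Rham cohomology).
-/

noncomputable section

open scoped Manifold ContDiff
open CategoryTheory AlgebraicGeometry
open Literature.NumberTheory.Transcendental Literature.Geometry.Kaehler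
open Literature.AlgebraicTopology.SingularHomology

namespace Literature.AlgebraicGeometry.HodgeTheory

section HodgeTheory

/-! ### Regular functions are holomorphic, hence smooth, on an analytic model of an affine scheme -/

namespace AnalyticModel

variable {E : Type} [NormedAddCommGroup E] [NormedSpace ℂ E] [FiniteDimensional ℂ E] {m : ℕ}
  {Y : Motives.SchemeOver ℂ}

/-- On an analytic model of an AFFINE `Y`, every global regular function `s ∈ Γ(Y, 𝒪)` is holomorphic
on all of `Y^an` (the field `IsAnalytification.mdifferentiableOn_evalOrZero` on the affine open `⊤`).
[cite: SerreGAGA1956, §2] -/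
theorem mdifferentiable_regularFun [IsAffine Y.left] (A : AnalyticModel E m Y) (s : Γ(Y.left, ⊤)) :
    MDifferentiable 𝓘(ℂ, E) 𝓘(ℂ, ℂ) (A.regularFun s) := by
  have h := A.isAnalytification.mdifferentiableOn_evalOrZero ⟨⊤, isAffineOpen_top Y.left⟩ s
  have huniv : A.toComplexPoints ⁻¹'
      {P : Motives.ComplexPoints Y |
        P.pt ∈ ((⟨⊤, isAffineOpen_top Y.left⟩ : Y.left.affineOpens) : Y.left.Opens)} = Set.univ :=
    Set.eq_univ_of_forall fun _ ↦ TopologicalSpace.Opens.mem_top _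
  rw [huniv, mdifferentiableOn_univ] at h
  exact h

/-- Global regular functions are real `C^∞` on an analytic model of an affine `Y` (holomorphic ⇒ `C^∞`,
Osgood; `MDifferentiable.contMDiff_real_of_complex`). [cite: SerreGAGA1956, §2] -/
theorem contMDiff_regularFun [IsAffine Y.left] (A : AnalyticModel E m Y) (s : Γ(Y.left, ⊤)) :
    ContMDiff 𝓘(ℝ, E) 𝓘(ℝ, ℂ) ∞ (A.regularFun s) :=
  (A.mdifferentiable_regularFun s).contMDiff_real_of_complex

/-- The `0`-form of a global regular function is a smooth form on an analytic model of an affine `Y`.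
[cite: SerreGAGA1956, §2] -/
theorem isSmoothForm_ofFun_regularFun [IsAffine Y.left] (A : AnalyticModel E m Y) (s : Γ(Y.left, ⊤)) :
    IsSmoothForm (MForm.ofFun 𝓘(ℝ, E) (A.regularFun s)) := fun x ↦
  MForm.smoothAt_ofFun_of_contMDiffAt (A.contMDiff_regularFun s x)

/-- Along a map `φ : A.carrier → B.carrier` OVER `Y(ℂ)` between two analytic models, regular functions
correspond: `s_B ∘ φ = s_A`. [cite: SerreGAGA1956, §2] -/
theorem regularFun_comp (A B : AnalyticModel E m Y) {φ : A.carrier → B.carrier}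
    (hcomm : B.toComplexPoints ∘ φ = A.toComplexPoints) (s : Γ(Y.left, ⊤)) :
    B.regularFun s ∘ φ = A.regularFun s := by
  funext x
  simp only [Function.comp_apply, AnalyticModel.regularFun]
  rw [← hcomm, Function.comp_apply]

end AnalyticModel

/-! ### Pull-back of iterated differentials along a `C^∞` map -/

section Pullback

variable {E : Type*} [NormedAddCommGroup E] [NormedSpace ℂ E]
  {E' : Type*} [NormedAddCommGroup E'] [NormedSpace ℂ E']
  {M : Type*} [TopologicalSpace M] [ChartedSpace E M]
  {N : Type*} [TopologicalSpace N] [ChartedSpace E' N]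

/-- `f^*` of the `0`-form of a function is the `0`-form of the composite (Warner (1983), 2.22); the two
manifolds may be charted on different model spaces. [cite: Warner1983, 2.22] -/
theorem pullback_ofFun (f : M → N) (g : N → ℂ) :
    (MForm.ofFun 𝓘(ℝ, E') g).pullback 𝓘(ℝ, E) f = MForm.ofFun 𝓘(ℝ, E) (g ∘ f) := by
  funext x
  ext v
  simp [MForm.pullback_apply]

variable [IsManifold 𝓘(ℝ, E) ∞ M] [IsManifold 𝓘(ℝ, E') ∞ N]

/-- `f^*(dg) = d(g ∘ f)` for a `C^∞` map `f` and a function `g` smooth as a `0`-form (naturality of `d`,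
Warner (1983), Prop. 2.23, through the unconditional pull-back calculus `instPullbackFacts`); the two
manifolds may be charted on different model spaces. [cite: Warner1983, Prop. 2.23] -/
theorem dFun_pullback {f : M → N} (hf : ContMDiff 𝓘(ℝ, E) 𝓘(ℝ, E') ∞ f) {g : N → ℂ}
    (hg : IsSmoothForm (MForm.ofFun 𝓘(ℝ, E') g)) :
    (dFun (E := E') g).pullback 𝓘(ℝ, E) f = dFun (E := E) (g ∘ f) := by
  unfold dFun
  rw [← mextDeriv_pullback hf hg, pullback_ofFun]

/-- `f^*(dg₀ ∧ ⋯ ∧ dg_{k-1}) = d(g₀ ∘ f) ∧ ⋯ ∧ d(g_{k-1} ∘ f)` for a `C^∞` map `f` and functions `gᵢ`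
smooth as `0`-forms (Warner (1983), 2.22(c) and 2.23); the two manifolds may be charted on different
model spaces. [cite: Warner1983, 2.22–2.23] -/
theorem dWedge_pullback {f : M → N} (hf : ContMDiff 𝓘(ℝ, E) 𝓘(ℝ, E') ∞ f) :
    ∀ (k : ℕ) (g : Fin k → (N → ℂ)), (∀ i, IsSmoothForm (MForm.ofFun 𝓘(ℝ, E') (g i))) →
      (dWedge (E := E') k g).pullback 𝓘(ℝ, E) f = dWedge (E := E) k (fun i ↦ g i ∘ f)
  | 0, g, _ => by
      simp only [dWedge]
      exact pullback_ofFun f _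
  | k + 1, g, hg => by
      simp only [dWedge]
      rw [MForm.pullback_castDeg, MForm.pullback_wedge, dFun_pullback hf (hg 0),
        dWedge_pullback hf k (Fin.tail g) (fun i ↦ hg i.succ)]
      rfl

end Pullback

/-! ### Realisations are natural in the model -/

section Models

variable {E : Type} [NormedAddCommGroup E] [NormedSpace ℂ E] [FiniteDimensional ℂ E] {m : ℕ}
  {Y : Motives.SchemeOver ℂ} {k : ℕ}

/-- **`φ^* (ξ.realize B) = ξ.realize A`** for two analytic models `A`, `B` of the smooth affine `Y` on
one model space and a `C^∞` map `φ : A.carrier → B.carrier` over `Y(ℂ)`: realisation of an algebraic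
form expression is natural in the analytic model (coefficients and arguments pull back to the same
regular functions read on `A`, and `φ^*` commutes with `d` and `∧`). Serre, GAGA §2 n°5 (fonctorialité);
Warner (1983), 2.22–2.23. [cite: SerreGAGA1956, §2 n°5] -/
theorem AlgFormExpr.realize_pullback [IsAffine Y.left] (ξ : AlgFormExpr Y k)
    (A B : AnalyticModel E m Y) {φ : A.carrier → B.carrier}
    (hφ : ContMDiff 𝓘(ℝ, E) 𝓘(ℝ, E) ∞ φ) (hcomm : B.toComplexPoints ∘ φ = A.toComplexPoints) :
    (ξ.realize B).pullback 𝓘(ℝ, E) φ = ξ.realize A := by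
  unfold AlgFormExpr.realize
  rw [← MForm.pullbackₗ_apply, map_sum]
  simp only [MForm.pullbackₗ_apply]
  refine Finset.sum_congr rfl fun j _ ↦ ?_
  have hargs : (fun i ↦ B.regularFun (ξ.arg j i) ∘ φ) = fun i ↦ A.regularFun (ξ.arg j i) :=
    funext fun i ↦ A.regularFun_comp B hcomm _
  have hw : (dWedge (E := E) (M := B.carrier) k fun i ↦ B.regularFun (ξ.arg j i)).pullback 𝓘(ℝ, E) φ =
      dWedge (E := E) (M := A.carrier) k fun i ↦ A.regularFun (ξ.arg j i) := by
    rw [dWedge_pullback hφ k _ fun i ↦ B.isSmoothForm_ofFun_regularFun _, hargs]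
  have hc : ∀ x, B.regularFun (ξ.coef j) (φ x) = A.regularFun (ξ.coef j) x := fun x ↦
    congrFun (A.regularFun_comp B hcomm (ξ.coef j)) x
  funext x
  have hwx := congrFun hw x
  ext v
  simp only [MForm.pullback_apply, ContinuousAlternatingMap.smul_apply]
  rw [hc x, ← hwx]
  rfl

/-- **On classes**: `φ^* [ξ.realize B] = [ξ.realize A]` in complex de Rham cohomology, for `φ` as in
`AlgFormExpr.realize_pullback`. Bott–Tu (1982), §I.2. [cite: BottTu1982Forms, §I.2] -/
theorem AlgFormExpr.map_mk_realize [IsAffine Y.left] (ξ : AlgFormExpr Y k)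
    (A B : AnalyticModel E m Y) {φ : A.carrier → B.carrier}
    (hφ : ContMDiff 𝓘(ℝ, E) 𝓘(ℝ, E) ∞ φ) (hcomm : B.toComplexPoints ∘ φ = A.toComplexPoints)
    (hB : ξ.realize B ∈ cclosedSmoothForms E B.carrier k)
    (hA : ξ.realize A ∈ cclosedSmoothForms E A.carrier k) :
    complexDeRhamCohomology.map E hφ k (complexDeRhamCohomology.mk E B.carrier k ⟨_, hB⟩) =
      complexDeRhamCohomology.mk E A.carrier k ⟨_, hA⟩ := by
  rw [complexDeRhamCohomology.map_mk]
  congr 1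
  exact Subtype.ext (ξ.realize_pullback A B hφ hcomm)

/-- Closedness of a realisation is itself model independent: `ξ.realize B` closed ⇒ `ξ.realize A` closed
(pull back along `φ` over `Y(ℂ)`). [cite: BottTu1982Forms, §I.2] -/
theorem AlgFormExpr.realize_mem_cclosedSmoothForms_of_comm [IsAffine Y.left] (ξ : AlgFormExpr Y k)
    (A B : AnalyticModel E m Y) {φ : A.carrier → B.carrier}
    (hφ : ContMDiff 𝓘(ℝ, E) 𝓘(ℝ, E) ∞ φ) (hcomm : B.toComplexPoints ∘ φ = A.toComplexPoints)
    (hB : ξ.realize B ∈ cclosedSmoothForms E B.carrier k) :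
    ξ.realize A ∈ cclosedSmoothForms E A.carrier k := by
  rw [← ξ.realize_pullback A B hφ hcomm]
  exact pullback_mem_cclosedSmoothForms hφ hB

/-- **Two analytic models of a smooth `Y` on one model space differ by a diffeomorphism over `Y(ℂ)`**:
a homeomorphism `h : A.carrier ≃ₜ B.carrier` with `B.toComplexPoints ∘ h = A.toComplexPoints`, `C^∞` in
both directions (uniqueness of the analytification up to biholomorphism, Serre GAGA §2 n°5 Prop. 2 —
`IsAnalytification.unique_holds` — and holomorphic ⇒ real `C^∞`). [cite: SerreGAGA1956, §2 n°5 Prop. 2] -/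
theorem AnalyticModel.exists_homeomorph [SmoothOfRelativeDimension m Y.hom] (A B : AnalyticModel E m Y) :
    ∃ h : A.carrier ≃ₜ B.carrier, ContMDiff 𝓘(ℝ, E) 𝓘(ℝ, E) ∞ h ∧
      ContMDiff 𝓘(ℝ, E) 𝓘(ℝ, E) ∞ h.symm ∧ B.toComplexPoints ∘ h = A.toComplexPoints := by
  haveI : Smooth Y.hom := SmoothOfRelativeDimension.smooth m Y.hom
  obtain ⟨h, h₁, h₂, h₃⟩ := IsAnalytification.unique_holds A.isAnalytification B.isAnalytification
  exact ⟨h, h₁.contMDiff_real_of_complex, h₂.contMDiff_real_of_complex, h₃⟩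

/-- `A^* = φ^* ∘ B^*` on `Hᵏ(–; ℂ)` for a continuous `φ : A.carrier → B.carrier` over `Y(ℂ)`
(functoriality of singular cohomology). [cite: HatcherAT2002, §3.1] -/
theorem AnalyticModel.pullback_comp_map (A B : AnalyticModel E m Y) {φ : A.carrier → B.carrier}
    (hφ : Continuous φ) (hcomm : B.toComplexPoints ∘ φ = A.toComplexPoints) (k : ℕ)
    (c : complexBetti Y k) :
    A.pullback k c = singularCohomology.map ℂ ℂ ⟨φ, hφ⟩ k (B.pullback k c) := by
  have hfac : (⟨A.toComplexPoints, A.isAnalytification.isHomeomorph.continuous⟩ :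
      C(A.carrier, Motives.ComplexPoints Y)) =
      (⟨B.toComplexPoints, B.isAnalytification.isHomeomorph.continuous⟩ :
        C(B.carrier, Motives.ComplexPoints Y)).comp ⟨φ, hφ⟩ :=
    ContinuousMap.ext fun x ↦ (congrFun hcomm x).symm
  change singularCohomology.map ℂ ℂ ⟨A.toComplexPoints, _⟩ k c = _
  rw [hfac, singularCohomology.map_comp, ConcreteCategory.comp_apply]

/-- **Reading a class through an expression does not depend on the analytic model.** For a NATURAL
complex de Rham family `e` on `E`-manifolds, two analytic models `A`, `B` of the smooth affine `Y` on
`E`, an expression `ξ` with closed realisations and `c ∈ Hᵏ(Y(ℂ); ℂ)`: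
`A^* c = e[ξ.realize A] ↔ B^* c = e[ξ.realize B]` (transport along the diffeomorphism over `Y(ℂ)` of
`AnalyticModel.exists_homeomorph`, naturality of `e` and of realisation). This is the independence of
the analytic model in clause (iii) of `chartConjugation_canonical` and in `ConjugationChart.Conjugates`.
[cite: SerreGAGA1956, §2 n°5 Prop. 2] [cite: BottTu1982Forms, §I.5] -/
theorem AlgFormExpr.pullback_eq_deRham_realize_iff [IsAffine Y.left] [SmoothOfRelativeDimension m Y.hom]
    {e : ComplexDeRhamIsoFamily E} (he : e.IsNatural) (ξ : AlgFormExpr Y k)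
    (A B : AnalyticModel E m Y) (hA : ξ.realize A ∈ cclosedSmoothForms E A.carrier k)
    (hB : ξ.realize B ∈ cclosedSmoothForms E B.carrier k) (c : complexBetti Y k) :
    A.pullback k c = e A.carrier k (complexDeRhamCohomology.mk E A.carrier k ⟨_, hA⟩) ↔
      B.pullback k c = e B.carrier k (complexDeRhamCohomology.mk E B.carrier k ⟨_, hB⟩) := by
  -- one direction, for an arbitrary `C^∞` map over `Y(ℂ)`
  have key : ∀ (A B : AnalyticModel E m Y) (hA : ξ.realize A ∈ cclosedSmoothForms E A.carrier k)
      (hB : ξ.realize B ∈ cclosedSmoothForms E B.carrier k) {φ : A.carrier → B.carrier}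
      (hφ : ContMDiff 𝓘(ℝ, E) 𝓘(ℝ, E) ∞ φ) (hcomm : B.toComplexPoints ∘ φ = A.toComplexPoints),
      B.pullback k c = e B.carrier k (complexDeRhamCohomology.mk E B.carrier k ⟨_, hB⟩) →
        A.pullback k c = e A.carrier k (complexDeRhamCohomology.mk E A.carrier k ⟨_, hA⟩) := by
    intro A B hA hB φ hφ hcomm h
    rw [A.pullback_comp_map B hφ.continuous hcomm k c, h, ← he _ _ φ hφ k,
      ξ.map_mk_realize A B hφ hcomm hB hA]
  obtain ⟨h, h₁, h₂, h₃⟩ := A.exists_homeomorph B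
  have h₃' : A.toComplexPoints ∘ h.symm = B.toComplexPoints := by
    rw [← h₃, Function.comp_assoc, Homeomorph.self_comp_symm, Function.comp_id]
  exact ⟨key B A hB hA h₂ h₃', key A B hA hB h₁ h₃⟩

end Models

/-! ### Realisations are natural along `ℂ`-morphisms of smooth schemes -/

section Morphisms

variable {E₁ : Type} [NormedAddCommGroup E₁] [NormedSpace ℂ E₁] [FiniteDimensional ℂ E₁]
  {E₂ : Type} [NormedAddCommGroup E₂] [NormedSpace ℂ E₂] [FiniteDimensional ℂ E₂]
  {m₁ m₂ : ℕ} {Y₁ Y₂ : Motives.SchemeOver ℂ} {k : ℕ}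

/-- The **pulled-back expression** `h^* ξ` on `Y₁` of an algebraic `k`-form expression `ξ` on `Y₂` along
a `ℂ`-morphism `h : Y₁ ⟶ Y₂`: apply `h^* : Γ(Y₂, 𝒪) → Γ(Y₁, 𝒪)` (`Scheme.Hom.appTop`) to all
coefficients and arguments — the functoriality `α ↦ h^* α` of regular differential forms, on
presentations (Grothendieck (1966), p. 96: functoriality of the algebraic de Rham complex).
[cite: Grothendieck1966deRham, p. 96] -/
def AlgFormExpr.pullback (h : Y₁ ⟶ Y₂) (ξ : AlgFormExpr Y₂ k) : AlgFormExpr Y₁ k where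
  size := ξ.size
  coef j := h.left.appTop (ξ.coef j)
  arg j i := h.left.appTop (ξ.arg j i)

/-- Size of the pulled-back expression (definitional). [folklore] -/
@[simp]
theorem AlgFormExpr.pullback_size (h : Y₁ ⟶ Y₂) (ξ : AlgFormExpr Y₂ k) : (ξ.pullback h).size = ξ.size :=
  rfl

/-- Coefficients of the pulled-back expression (definitional). [folklore] -/
@[simp]
theorem AlgFormExpr.pullback_coef (h : Y₁ ⟶ Y₂) (ξ : AlgFormExpr Y₂ k) (j : Fin ξ.size) :
    (ξ.pullback h).coef j = h.left.appTop (ξ.coef j) :=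
  rfl

/-- Arguments of the pulled-back expression (definitional). [folklore] -/
@[simp]
theorem AlgFormExpr.pullback_arg (h : Y₁ ⟶ Y₂) (ξ : AlgFormExpr Y₂ k) (j : Fin ξ.size) (i : Fin k) :
    (ξ.pullback h).arg j i = h.left.appTop (ξ.arg j i) :=
  rfl

namespace AnalyticModel

/-- The **analytified morphism** `h^an : Y₁^an → Y₂^an` between analytic models of `Y₁`, `Y₂` along a
`ℂ`-morphism `h : Y₁ ⟶ Y₂`: `ψ₂⁻¹ ∘ h(ℂ) ∘ ψ₁` with `ψᵢ` the comparison homeomorphisms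
(Serre, GAGA §2 n°5, fonctorialité de `X^h`). [cite: SerreGAGA1956, §2 n°5] -/
def anMap (A₁ : AnalyticModel E₁ m₁ Y₁) (A₂ : AnalyticModel E₂ m₂ Y₂) (h : Y₁ ⟶ Y₂) :
    A₁.carrier → A₂.carrier :=
  A₂.isAnalytification.homeomorph.symm ∘ Motives.AlgPoints.map h ∘ A₁.toComplexPoints

variable (A₁ : AnalyticModel E₁ m₁ Y₁) (A₂ : AnalyticModel E₂ m₂ Y₂) (h : Y₁ ⟶ Y₂)

/-- `h^an` covers `h(ℂ)`: `ψ₂ ∘ h^an = h(ℂ) ∘ ψ₁`. [cite: SerreGAGA1956, §2 n°5] -/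
theorem toComplexPoints_comp_anMap :
    A₂.toComplexPoints ∘ A₁.anMap A₂ h = Motives.AlgPoints.map h ∘ A₁.toComplexPoints := by
  funext x
  simp only [Function.comp_apply, anMap]
  exact A₂.isAnalytification.homeomorph.apply_symm_apply _

/-- `h^an` covers `h(ℂ)`, pointwise. [cite: SerreGAGA1956, §2 n°5] -/
theorem toComplexPoints_anMap (x : A₁.carrier) :
    A₂.toComplexPoints (A₁.anMap A₂ h x) = Motives.AlgPoints.map h (A₁.toComplexPoints x) :=
  congrFun (A₁.toComplexPoints_comp_anMap A₂ h) x

/-- `h^an` is continuous (`h(ℂ)` is, `AlgPoints.continuous_map`). [cite: SerreGAGA1956, §2 n°5] -/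
theorem continuous_anMap : Continuous (A₁.anMap A₂ h) :=
  A₂.isAnalytification.homeomorph.symm.continuous.comp
    ((Motives.AlgPoints.continuous_map h).comp A₁.isAnalytification.isHomeomorph.continuous)

/-- **Algebraic morphisms are holomorphic**: `h^an` is holomorphic for `Y₁`, `Y₂` smooth over `ℂ`
(Serre, GAGA §2 n°5 p. 9; `IsAnalytification.mdifferentiable_comp_map_holds`).
[cite: SerreGAGA1956, §2 n°5 p. 9 (fonctorialité de X^h)] -/
theorem mdifferentiable_anMap [SmoothOfRelativeDimension m₁ Y₁.hom] [SmoothOfRelativeDimension m₂ Y₂.hom] :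
    MDifferentiable 𝓘(ℂ, E₁) 𝓘(ℂ, E₂) (A₁.anMap A₂ h) := by
  haveI : Smooth Y₁.hom := SmoothOfRelativeDimension.smooth m₁ Y₁.hom
  haveI : Smooth Y₂.hom := SmoothOfRelativeDimension.smooth m₂ Y₂.hom
  exact IsAnalytification.mdifferentiable_comp_map_holds A₁.isAnalytification A₂.isAnalytification h _
    (A₁.toComplexPoints_comp_anMap A₂ h)

/-- `h^an` is real `C^∞` (holomorphic ⇒ `C^∞`). [cite: SerreGAGA1956, §2 n°5 p. 9 (fonctorialité de X^h)] -/
theorem contMDiff_anMap [SmoothOfRelativeDimension m₁ Y₁.hom] [SmoothOfRelativeDimension m₂ Y₂.hom] :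
    ContMDiff 𝓘(ℝ, E₁) 𝓘(ℝ, E₂) ∞ (A₁.anMap A₂ h) :=
  (A₁.mdifferentiable_anMap A₂ h).contMDiff_real_of_complex

/-- **Pulled-back regular functions read on `Y₁^an` are regular functions read on `Y₂^an` composed with
`h^an`**: `(h^* s)_{A₁} = s_{A₂} ∘ h^an` (naturality of evaluation at complex points,
`AlgPoints.eval_map`). [cite: SerreGAGA1956, §2 n°5] -/
theorem regularFun_appTop (s : Γ(Y₂.left, ⊤)) :
    A₁.regularFun (h.left.appTop s) = A₂.regularFun s ∘ A₁.anMap A₂ h := by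
  funext x
  simp only [Function.comp_apply, AnalyticModel.regularFun, toComplexPoints_anMap]
  rw [Motives.AlgPoints.evalOrZero_of_mem _ (TopologicalSpace.Opens.mem_top _),
    Motives.AlgPoints.evalOrZero_of_mem _ (TopologicalSpace.Opens.mem_top _),
    Motives.AlgPoints.eval_map]
  rfl

/-- `A₁^* ∘ h^* = (h^an)^* ∘ A₂^*` on `Hᵏ(–; ℂ)` (functoriality of singular cohomology and
`ψ₂ ∘ h^an = h(ℂ) ∘ ψ₁`). [cite: HatcherAT2002, §3.1] -/
theorem pullback_map_eq (c : complexBetti Y₂ k) :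
    A₁.pullback k (complexBetti.map h k c) =
      singularCohomology.map ℂ ℂ ⟨A₁.anMap A₂ h, A₁.continuous_anMap A₂ h⟩ k (A₂.pullback k c) := by
  have hfac : (Motives.AlgPoints.mapContinuous (L := ℂ) h).comp
        (⟨A₁.toComplexPoints, A₁.isAnalytification.isHomeomorph.continuous⟩ :
          C(A₁.carrier, Motives.ComplexPoints Y₁)) =
      (⟨A₂.toComplexPoints, A₂.isAnalytification.isHomeomorph.continuous⟩ :
          C(A₂.carrier, Motives.ComplexPoints Y₂)).comp ⟨A₁.anMap A₂ h, A₁.continuous_anMap A₂ h⟩ :=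
    ContinuousMap.ext fun x ↦ by
      simp only [ContinuousMap.comp_apply, ContinuousMap.coe_mk, Motives.AlgPoints.mapContinuous_apply]
      exact (A₁.toComplexPoints_anMap A₂ h x).symm
  change singularCohomology.map ℂ ℂ ⟨A₁.toComplexPoints, _⟩ k
      (singularCohomology.map ℂ ℂ (Motives.AlgPoints.mapContinuous (L := ℂ) h) k c) = _
  rw [← ConcreteCategory.comp_apply, ← singularCohomology.map_comp, hfac, singularCohomology.map_comp,
    ConcreteCategory.comp_apply]

end AnalyticModel

/-- **Realisation is natural along morphisms**: `(h^an)^* (ξ.realize A₂) = (h^* ξ).realize A₁` for a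
`ℂ`-morphism `h : Y₁ ⟶ Y₂` of smooth schemes with `Y₂` affine, analytic models `A₁`, `A₂` (on possibly
different model spaces) and an algebraic `k`-form expression `ξ` on `Y₂` (coefficients and arguments
transform by `regularFun_appTop`; `(h^an)^*` commutes with `d` and `∧`). Serre, GAGA §2 n°5;
Grothendieck (1966), p. 96 (functoriality of the comparison). [cite: SerreGAGA1956, §2 n°5] -/
theorem AlgFormExpr.realize_pullback_anMap [IsAffine Y₂.left] [SmoothOfRelativeDimension m₁ Y₁.hom]
    [SmoothOfRelativeDimension m₂ Y₂.hom] (ξ : AlgFormExpr Y₂ k)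
    (A₁ : AnalyticModel E₁ m₁ Y₁) (A₂ : AnalyticModel E₂ m₂ Y₂) (h : Y₁ ⟶ Y₂) :
    (ξ.realize A₂).pullback 𝓘(ℝ, E₁) (A₁.anMap A₂ h) = (ξ.pullback h).realize A₁ := by
  have hφ := A₁.contMDiff_anMap A₂ h
  unfold AlgFormExpr.realize
  rw [← MForm.pullbackₗ_apply, map_sum]
  simp only [MForm.pullbackₗ_apply]
  refine Finset.sum_congr rfl fun j _ ↦ ?_
  have hargs : (fun i ↦ A₂.regularFun (ξ.arg j i) ∘ A₁.anMap A₂ h) =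
      fun i ↦ A₁.regularFun (h.left.appTop (ξ.arg j i)) :=
    funext fun i ↦ (A₁.regularFun_appTop A₂ h _).symm
  have hw : (dWedge (E := E₂) (M := A₂.carrier) k fun i ↦ A₂.regularFun (ξ.arg j i)).pullback 𝓘(ℝ, E₁)
        (A₁.anMap A₂ h) =
      dWedge (E := E₁) (M := A₁.carrier) k fun i ↦ A₁.regularFun (h.left.appTop (ξ.arg j i)) := by
    rw [dWedge_pullback hφ k _ fun i ↦ A₂.isSmoothForm_ofFun_regularFun _, hargs]
  have hc : ∀ x, A₂.regularFun (ξ.coef j) (A₁.anMap A₂ h x) = A₁.regularFun (h.left.appTop (ξ.coef j)) x :=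
    fun x ↦ (congrFun (A₁.regularFun_appTop A₂ h (ξ.coef j)) x).symm
  funext x
  have hwx := congrFun hw x
  ext v
  simp only [MForm.pullback_apply, ContinuousAlternatingMap.smul_apply, AlgFormExpr.pullback_coef,
    AlgFormExpr.pullback_arg]
  rw [hc x, ← hwx]
  rfl

/-- Closedness transfers to the pulled-back expression: `ξ.realize A₂` closed ⇒ `(h^* ξ).realize A₁`
closed. [cite: BottTu1982Forms, §I.2] -/
theorem AlgFormExpr.realize_pullback_mem_cclosedSmoothForms [IsAffine Y₂.left]
    [SmoothOfRelativeDimension m₁ Y₁.hom] [SmoothOfRelativeDimension m₂ Y₂.hom] (ξ : AlgFormExpr Y₂ k)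
    (A₁ : AnalyticModel E₁ m₁ Y₁) (A₂ : AnalyticModel E₂ m₂ Y₂) (h : Y₁ ⟶ Y₂)
    (hA₂ : ξ.realize A₂ ∈ cclosedSmoothForms E₂ A₂.carrier k) :
    (ξ.pullback h).realize A₁ ∈ cclosedSmoothForms E₁ A₁.carrier k := by
  rw [← ξ.realize_pullback_anMap A₁ A₂ h]
  exact pullback_mem_cclosedSmoothForms (A₁.contMDiff_anMap A₂ h) hA₂

/-- **On classes**: `(h^an)^* [ξ.realize A₂] = [(h^* ξ).realize A₁]` in complex de Rham cohomology.
[cite: BottTu1982Forms, §I.2] -/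
theorem AlgFormExpr.map_mk_realize_anMap [IsAffine Y₂.left] [SmoothOfRelativeDimension m₁ Y₁.hom]
    [SmoothOfRelativeDimension m₂ Y₂.hom] (ξ : AlgFormExpr Y₂ k)
    (A₁ : AnalyticModel E₁ m₁ Y₁) (A₂ : AnalyticModel E₂ m₂ Y₂) (h : Y₁ ⟶ Y₂)
    (hA₂ : ξ.realize A₂ ∈ cclosedSmoothForms E₂ A₂.carrier k)
    (hA₁ : (ξ.pullback h).realize A₁ ∈ cclosedSmoothForms E₁ A₁.carrier k) :
    complexDeRhamCohomology.map E₁ (A₁.contMDiff_anMap A₂ h) k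
        (complexDeRhamCohomology.mk E₂ A₂.carrier k ⟨_, hA₂⟩) =
      complexDeRhamCohomology.mk E₁ A₁.carrier k ⟨_, hA₁⟩ := by
  rw [complexDeRhamCohomology.map_mk]
  congr 1
  exact Subtype.ext (ξ.realize_pullback_anMap A₁ A₂ h)

/-- **Reading classes through expressions is natural along morphisms (one model space).** For a
NATURAL complex de Rham family `e` on `E`-manifolds, analytic models `A₁`, `A₂` of the smooth `Y₁`, `Y₂`
on the same `E` (`Y₂` affine), a `ℂ`-morphism `h : Y₁ ⟶ Y₂` and an expression `ξ` on `Y₂` with closed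
realisation: if `A₂^* c = e[ξ.realize A₂]` then `A₁^* (h^* c) = e[(h^* ξ).realize A₁]`. (For models on
different model spaces the statement needs a de Rham family natural across model spaces, which
`ComplexDeRhamIsoFamily.IsNatural` does not provide; use `AnalyticModel.pullback_map_eq` and
`AlgFormExpr.map_mk_realize_anMap`.) Grothendieck (1966), p. 96 (functoriality of the comparison
isomorphism); Serre, GAGA §2 n°5. [cite: Grothendieck1966deRham, p. 96] [cite: SerreGAGA1956, §2 n°5] -/
theorem AlgFormExpr.pullback_map_eq_deRham_realize {E : Type} [NormedAddCommGroup E] [NormedSpace ℂ E]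
    [FiniteDimensional ℂ E] [IsAffine Y₂.left] [SmoothOfRelativeDimension m₁ Y₁.hom]
    [SmoothOfRelativeDimension m₂ Y₂.hom] {e : ComplexDeRhamIsoFamily E} (he : e.IsNatural)
    (ξ : AlgFormExpr Y₂ k) (A₁ : AnalyticModel E m₁ Y₁) (A₂ : AnalyticModel E m₂ Y₂) (h : Y₁ ⟶ Y₂)
    (hA₂ : ξ.realize A₂ ∈ cclosedSmoothForms E A₂.carrier k)
    (hA₁ : (ξ.pullback h).realize A₁ ∈ cclosedSmoothForms E A₁.carrier k) (c : complexBetti Y₂ k)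
    (hc : A₂.pullback k c = e A₂.carrier k (complexDeRhamCohomology.mk E A₂.carrier k ⟨_, hA₂⟩)) :
    A₁.pullback k (complexBetti.map h k c) =
      e A₁.carrier k (complexDeRhamCohomology.mk E A₁.carrier k ⟨_, hA₁⟩) := by
  rw [A₁.pullback_map_eq A₂ h c, hc, ← he _ _ _ (A₁.contMDiff_anMap A₂ h) k,
    ξ.map_mk_realize_anMap A₁ A₂ h hA₂ hA₁]

end Morphisms

/-! ### Model independence across model SPACES (two models of one `Y` on `E₁`, `E₂`) -/

section CrossModelSpace

variable {E₁ : Type} [NormedAddCommGroup E₁] [NormedSpace ℂ E₁] [FiniteDimensional ℂ E₁]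
  {E₂ : Type} [NormedAddCommGroup E₂] [NormedSpace ℂ E₂] [FiniteDimensional ℂ E₂]
  {m₁ m₂ : ℕ} {Y : Motives.SchemeOver ℂ} {k : ℕ}

/-- `(𝟙 Y)^* ξ = ξ` (definitionally, `𝟙^* = 𝟙` on global sections). [folklore] -/
@[simp]
theorem AlgFormExpr.pullback_id (ξ : AlgFormExpr Y k) : ξ.pullback (𝟙 Y) = ξ := by
  cases ξ
  simp only [AlgFormExpr.pullback, Over.id_left, Scheme.Hom.id_appTop]
  rfl

/-- **Realisation does not depend on the model space either**: for analytic models `A` on `E₁` and `B` on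
`E₂` of the same smooth affine `Y`, `(𝟙^an)^* (ξ.realize B) = ξ.realize A`, where
`𝟙^an = ψ_B⁻¹ ∘ ψ_A : A.carrier → B.carrier` (`AnalyticModel.anMap A B (𝟙 Y)`) is the comparison
biholomorphism of the two analytifications (Serre, GAGA §2 n°5 Prop. 2). [cite: SerreGAGA1956, §2 n°5 Prop. 2] -/
theorem AlgFormExpr.realize_pullback_anMap_id [IsAffine Y.left] [SmoothOfRelativeDimension m₁ Y.hom]
    [SmoothOfRelativeDimension m₂ Y.hom] (ξ : AlgFormExpr Y k) (A : AnalyticModel E₁ m₁ Y)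
    (B : AnalyticModel E₂ m₂ Y) :
    (ξ.realize B).pullback 𝓘(ℝ, E₁) (A.anMap B (𝟙 Y)) = ξ.realize A := by
  simpa only [AlgFormExpr.pullback_id] using ξ.realize_pullback_anMap A B (𝟙 Y)

/-- Closedness of a realisation does not depend on the model space. [cite: BottTu1982Forms, §I.2] -/
theorem AlgFormExpr.realize_mem_cclosedSmoothForms_of_model [IsAffine Y.left]
    [SmoothOfRelativeDimension m₁ Y.hom] [SmoothOfRelativeDimension m₂ Y.hom] (ξ : AlgFormExpr Y k)
    (A : AnalyticModel E₁ m₁ Y) (B : AnalyticModel E₂ m₂ Y)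
    (hB : ξ.realize B ∈ cclosedSmoothForms E₂ B.carrier k) :
    ξ.realize A ∈ cclosedSmoothForms E₁ A.carrier k := by
  rw [← ξ.realize_pullback_anMap_id A B]
  exact pullback_mem_cclosedSmoothForms (A.contMDiff_anMap B (𝟙 Y)) hB

/-- On classes: `(𝟙^an)^* [ξ.realize B] = [ξ.realize A]` across model spaces. [cite: BottTu1982Forms, §I.2] -/
theorem AlgFormExpr.map_mk_realize_anMap_id [IsAffine Y.left] [SmoothOfRelativeDimension m₁ Y.hom]
    [SmoothOfRelativeDimension m₂ Y.hom] (ξ : AlgFormExpr Y k) (A : AnalyticModel E₁ m₁ Y)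
    (B : AnalyticModel E₂ m₂ Y) (hB : ξ.realize B ∈ cclosedSmoothForms E₂ B.carrier k)
    (hA : ξ.realize A ∈ cclosedSmoothForms E₁ A.carrier k) :
    complexDeRhamCohomology.map E₁ (A.contMDiff_anMap B (𝟙 Y)) k
        (complexDeRhamCohomology.mk E₂ B.carrier k ⟨_, hB⟩) =
      complexDeRhamCohomology.mk E₁ A.carrier k ⟨_, hA⟩ := by
  rw [complexDeRhamCohomology.map_mk]
  congr 1
  exact Subtype.ext (ξ.realize_pullback_anMap_id A B)

/-- `A^* = (𝟙^an)^* ∘ B^*` on `Hᵏ(Y(ℂ); ℂ)` for two models on possibly different model spaces.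
[cite: HatcherAT2002, §3.1] -/
theorem AnalyticModel.pullback_eq_map_anMap_id (A : AnalyticModel E₁ m₁ Y) (B : AnalyticModel E₂ m₂ Y)
    (c : complexBetti Y k) :
    A.pullback k c =
      singularCohomology.map ℂ ℂ ⟨A.anMap B (𝟙 Y), A.continuous_anMap B (𝟙 Y)⟩ k (B.pullback k c) := by
  simpa only [complexBetti.map_id, ModuleCat.id_apply] using A.pullback_map_eq B (𝟙 Y) c

end CrossModelSpace

end HodgeTheory

end Literature.AlgebraicGeometry.HodgeTheory
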